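import Literature.MathematicalPhysics.QuantumFieldTheory.Balaban1983to89.B12Ineq418Flat
import Literature.MathematicalPhysics.QuantumFieldTheory.Balaban1983to89.B14Eq349IrrelevantFeed
import Literature.MathematicalPhysics.QuantumFieldTheory.Balaban1983to89.B14Eq366Irrelevant

/-!
# `Balaban1983to89.B14.LettersScaleN` — [Balaban1988Convergent] p. 276 / p. 280: «we obtain all the formulas and
# bounds of Sects. 3, 4 [I] with η replaced by L⁻ⁿ», «satisfies the bound (I.3.32), but in the L⁻ⁿ-scale instead of
# the η-scale» — the regularity LETTERS of the §3 consumers (the (3.49) remainders `…B14.Eq349IrrelevantFeed` and the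
# (3.66) terms `…B14.Eq366Irrelevant`) KNITTED to the landed [I]-side theorems (I.4.17)/(I.4.18)
# (`…B12Ineq417Flat`, `…B12Ineq418Flat`) at `η := L⁻ⁿ`, and to (2.38) read at a point of scale `n`

HONEST FRAMING (cell `pub-ymgap`, Track A DAG node N11 = [B14]; count-neutral SLOT input): a KNIT of landed theorems to
landed consumers — no new estimate of Bałaban's is claimed; the flat-background / `ℤ^d` model of the [I]-side files is
inherited as is; Bałaban's minimizers `U_k` are not instantiated; one finite T⁴ programme at fixed ε; nothing here is a
claim about the continuum, ℝ⁴, OS axioms, a mass gap or the Clay problem.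

CITATION HEADER (lean-in-tree rule).  T. Bałaban, *Convergent renormalization expansions for lattice gauge theories*,
Commun. Math. Phys. **119** (1988) 243–285, doi:10.1007/bf01217741 [Balaban1988Convergent] (cell paper B14 = «[III]»;
held text `paper:balaban1988-cmp119-convergent-renormalization`, journal page = PDF page + 242; p. 276 [PDF 34], p. 280
[PDF 38], p. 261 [PDF 19] read from the text layer by the author of this file, 2026-08-25); T. Bałaban, *Renormalization
group approach to lattice gauge field theories. I*, Commun. Math. Phys. **109** (1987) 249–301 [Balaban1987RG1] («[I]»;
held `paper:balaban1987-cmp109-rg-i-small-field`, p. 277 (3.32), p. 285 (4.16)–(4.18), p. 286 (4.23)).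
THE PRINT, verbatim.  [III] p. 276: *«In all bounds connected with such a cube we have to replace η = L⁻ᵏ by L⁻ⁿ. …
Other bounds involve regularity properties of the configuration U_{k+1} on a neighborhood of Ω_n∖Ω_{n+1}, and these are
the same as for U_M-configurations, i.e. they are characterized by the scale L⁻ⁿ. Thus, for terms connected with such a
cube □, we obtain all the formulas and bounds of Sects. 3, 4 [I] with η replaced by L⁻ⁿ.»*; p. 280: *«The function
U_k^{ηA}, where A is defined by (I.3.30), satisfies the bound (I.3.32), but in the L⁻ⁿ-scale instead of the η-scale. …
To the sum on the right-hand side (I.3.34) we apply the considerations of Sect. 4 [I] … we move the factors B to the point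
z instead of the point x.»*; p. 261 (2.38): *«there exists a gauge transformation u defined on □∩X and such, that
U^u = exp iξA, Lⁿξ|A|, (Lⁿξ)²|∇^ξA| < BCMα_{0,n} (2.38) on □∩X, with an absolute constant B»*; p. 283 (3.66):
*«Analyzing A(h_z, U_k) in the same way as above, we obtain A(h_z, U_k) = ½Σ_{μ<ν} tr F²_{μν}(z) + (the irrelevant
terms).»*  [I] p. 277 (3.32): *«|A|, |∇^ηA|, ‖A‖_{1,β} < 2(α₂ + B₃O(1)Mα₀) on □₄»*; p. 285: *«|(∂_νB_μ)(x)| < O(1)(α₂ +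
B₃O(1)Mα₀)(Lʲη)² < α₁(Lʲη)² (4.17) … |(∂_λ∂_νB_μ)(x)| < α₁(Lʲη)^{2+β}, 0 ≦ β ≦ β₀ < 1 (4.18)»*; p. 286 (4.23):
*«B_{μ₃}(x) = (∂_{μ₃}λ_x)(x₃), λ_x(x₃) = Σ_ν (x_{3,ν} − x_ν)B_ν(x)»*.

WHY THIS FILE (cell `pub-ymgap`, dag-lead's DIVISION OF RECORD for node N11, HOME/INBOX l. 9370; `lit-balaban-r11/
B14-CLOSURE.md` §3 item 2(iii)).  The §3 files of the tree that estimate «the irrelevant terms» of (3.67) at a point `z` of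
scale `n` (`z ∈ Λ_j⁰∩(Ω_n∖Ω_{n+1})`) carry the regularity of the background as LETTERS at the scale `σ = LʲL⁻ⁿ`:
`…Eq349IrrelevantFeed.perPointIrrelevant_of_charts` takes four field pieces `c, λ_z, ℓ, B − c − ℓ` of sizes `aσ, aσ, aσ²,
aσ²σ^{1−β}` ((I.4.16)–(I.4.18) read around `z`), and `…Eq366Irrelevant.irrelevant366_le_selfAdjoint` takes the sup,
gradient and Hölder letters `aσ, ξ·aσ², ξ·aσ²θ` of the raw bond field on the window of `h_z`.  On the [I] side the tree
PROVES (4.17)/(4.18) for the localized averaged field `B_μ(x) = ζ̃_□(x)Q_{j,μ}(ηA, x)` at the flat background, for a FREE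
positive real `η` (`…B12Ineq417Flat.ineq417_flat_scaled`, `…B12Ineq418Flat.ineq418_flat_scaled`).  Print's sentence
«with η replaced by L⁻ⁿ» is therefore an INSTANTIATION, and the passage from the unit-lattice field to the four pieces is a
discrete Taylor expansion around `z`; neither was a theorem of the tree.  This file supplies both, and the (2.38)
dictionary for the (3.66) consumer, BY NAME (nothing restated, no `def`, no `sorry`).

DICTIONARY (b07's flat variables, as in `…B12Ineq417Flat`: the fine lattice `T_ξ` is `ℤ^d` with UNIT steps, the unit
lattice `T₁^{(j)}` is indexed by `z ∈ ℤ^d` (site `Lʲz`), its step `e_ν` is `Lʲ` fine steps; the fine bond field entering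
the averaging is `η•A`).  At a point of scale `n ≥ j` the n-th unit length is `Lⁿ` fine steps, so (2.38)'s
`Lⁿξ|A_phys| < c`, `(Lⁿξ)²|∇^ξA_phys| < c` say exactly: the fine bond field `𝔟 = ξA_phys` has `‖𝔟‖ ≤ L⁻ⁿc` and fine
differences `≤ (L⁻ⁿ)²c`, i.e. `𝔟 = η•A` with `η = L⁻ⁿ`, `‖A‖ ≤ c`, `‖A(x + e_ν) − A(x)‖ ≤ η·c` — the hypotheses `hA`,
`hA'` of `ineq417_flat_scaled` AT `η := (Lⁿ)⁻¹`; and `Lʲη = LʲL⁻ⁿ = σ`.  The Hölder member `‖A‖_{1,β}` of (I.3.32) «in the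
L⁻ⁿ-scale» is the coarse variation of the fine gradient `≤ η·a″θ`, `θ = σ^{β₀}` (`hA2` of `ineq418_flat_scaled`); it is
NOT a member of (2.34)–(2.39) — for Bałaban's `U_k` its source is [15] Thm 1 / (I.3.30)–(3.32), carried here as a letter
exactly as the [I]-side file carries it.

WHAT IS PROVED (kernel-checked, theorems only, no `def`, no `sorry`, standard axioms).
§1 «η replaced by L⁻ⁿ» for (I.4.17)/(I.4.18): `norm_locB_scaleN` (`‖B_μ(x)‖ ≤ 2a·σ`), `ineq417_scaleN`
(`‖∂_νB_μ(x)‖ ≤ (2c₁a + 4da′)·σ²`), `ineq418_scaleN` (`‖∂_λ∂_νB_μ(x)‖ ≤ (4da″ + 32C₃a′² + 8dc₁a′ + 2c₂a)·σ²θ`) for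
`B = ζ̃·Q_j(1, L⁻ⁿ•A)` on `ℤ^d`, `σ = LʲL⁻ⁿ`, `j ≤ n`, under the (2.38)-shaped sizes of `A`, the Hölder letter, the
profile letters `|ζ̃| ≤ 1`, `|Δζ̃| ≤ c₁σ`, `|ΔΔζ̃| ≤ c₂σ²`, and b07's smallness `C₃σ(2a + 4σa′) ≤ 1` — the [I]-side
theorems BY NAME at `η := (Lⁿ)⁻¹` (private scale algebra: `Lʲ(Lⁿ)⁻¹ = L^{(j:ℝ)−n}`, the consumers' letter, and `σ ≤ σ^{β₀} ≤ 1`).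
§2 (folklore) discrete Taylor on `ℤ^d`: `norm_sub_le_l1dist_mul` (`‖f(x) − f(z)‖ ≤ |x − z|₁·s₁` from unit differences
`≤ s₁`) and `norm_taylor2_le_l1dist_sq_mul` (`‖f(x) − f(z) − Σ_ν(x − z)_ν•Δ_νf(z)‖ ≤ |x − z|₁²·s₂` from second
differences `≤ s₂`), by induction on the ℓ¹-distance.
§3 THE FOUR PIECES of `perPointIrrelevant_of_charts` for the unit-lattice field read on a window `ι : T → ℤ^d` of
ℓ¹-radius `R` about `z` (`T` a finite index type, directions `Fin d`): `c = B(z)`, `λ_z(x) = Σ_ν(x − z)_νB_ν(z)` ((I.4.23)),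
`ℓ(x) = Σ_ν(x − z)_ν∂_νB(z)`, and the remainder, with `norm_piece_c_le` (`2aσ`), `norm_piece_lam_le` (`R·2aσ`),
`norm_piece_ell_le` (`R·C₁σ²`), `norm_piece_rem_le` (`R²·C₂σ²θ`), assembled in the consumer's literal rpow shape
`a⋆L^{(j:ℝ)−n}`, `a⋆(L^{(j:ℝ)−n})²`, `a⋆(L^{(j:ℝ)−n})²(L^{(j:ℝ)−n})^{1−b}` with ONE letter
`a⋆ = 2a(1 + R) + RC₁ + R²C₂` (`pieces_printedShape`, Hölder exponent `β₀ = 1 − b`, `b ∈ [0, 1]` print's «positive number»).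
§4 THE (3.66) CONSUMER: `irrelevant366_le_of_letters238` — the landed `irrelevant366_le_selfAdjoint` under (2.38) READ IN
j-UNITS on the window of `h_z` (`σ⁻¹‖B‖ ≤ c`, `σ⁻²ξ⁻¹‖∇B‖ ≤ c`: the n-th unit length is `σ⁻¹` j-units, `ξ = L⁻ʲ =
(N + 1)⁻¹`) and the Hölder letter at scale `n` (`σ⁻²ξ⁻¹‖∇B(x) − ∇B(z)‖ ≤ cσ^{β₀}`), `θ = σ^{β₀}`: the (3.66) estimate
`≤ c₂(4c)·σ⁴σ^{β₀}` with no letter left but print's.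
§5 THE (3.49) CONSUMER END TO END: `perPointIrrelevant_of_letters` — the landed `perPointIrrelevant_of_charts` with its
chart-field pieces `c, λ_z, ℓ, B` TAKEN TO BE the window field of §3 and its Taylor pieces (definitional hypotheses,
instantiated by `rfl`) and its four letters DISCHARGED by `pieces_printedShape` (any `a ≥ a⋆`); the cube system, the
charts with (2.27)(ii)+(iv) and the remainder hypothesis `hi` pass through verbatim:
`|Σ_{X∈𝒜} i(X)| ≤ (C·E₀·K₀(c₀, Δ))·(L^{(j:ℝ)−n})^{5−β}`.

WHAT IS NOT PROVED HERE (and not claimed).  (i) That Bałaban's `U_k(V)` near a point of `Λ_j⁰∩(Ω_n∖Ω_{n+1})` satisfies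
(2.38) (it is clause (ii) of the space `Ũ^c_j`, `…B14RegularSpaces234.CondII238`, an inductive hypothesis of Theorem 1)
or the Hölder letter ([15] Thm 1; (I.3.30)–(3.32)); (ii) the identification of [III]'s background near `z` with b07's
flat objects `U₀ = 1` of the [I]-side files (their own DIVERGENCE, inherited verbatim: «flat background only»); (iii)
the global-on-`ℤ^d` form of the [I]-side hypotheses is kept (the averaging is local, `…B7Prop5Flat.logIter_congr`, so
only the box of `z` matters, but no restriction theorem is stated here); (iv) the one-carrier instantiation of
`Sect2Data` / the term identification (2.27)(i) (B14-CLOSURE §3 item 2(ii)–(iii)) — object tasks of NODE 00.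
Unit `pub-ymgap-dag-n11-b` (generation 2), HOME `run/shared/lean/pub/pub-ymgap/`; bears on R4∕N11 only through the
letters of `PointDataE`'s `I₁`, `I₂`.

## References
* [Balaban1988Convergent] T. Bałaban, Commun. Math. Phys. 119 (1988) 243–285: p.276, p.280, (2.38) p.261, (3.49) p.280, (3.66) p.283.
* [Balaban1987RG1] T. Bałaban, Commun. Math. Phys. 109 (1987) 249–301 ([I]: (3.32) p.277, (4.16)–(4.18) p.285, (4.23) p.286).
* [Balaban1985Averaging] T. Bałaban, Commun. Math. Phys. 98 (1985) 17–51 ([7]: Prop. 4 p.38, Prop. 5 (156) p.42 — through the [I]-side files).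
-/

noncomputable section

open scoped BigOperators
open Finset
open Literature.MathematicalPhysics.QuantumFieldTheory.Balaban1983to89
open Literature.MathematicalPhysics.QuantumFieldTheory.Balaban1983to89.B7Prop1Explicit (e)
open Literature.MathematicalPhysics.QuantumFieldTheory.Balaban1983to89.B7Prop5Flat (C3 C3_pos)
open Literature.MathematicalPhysics.QuantumFieldTheory.Balaban1983to89.B12Ineq417Flat (locB dlocB norm_logIter_le
  ineq417_flat_scaled)
open Literature.MathematicalPhysics.QuantumFieldTheory.Balaban1983to89.B12Ineq418Flat (ddlocB ineq418_flat_scaled)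

namespace Literature.MathematicalPhysics.QuantumFieldTheory.Balaban1983to89.B14.LettersScaleN

variable {d : ℕ}

/-! ## §1. «η replaced by L⁻ⁿ»: (I.4.17), (I.4.18) and the size of `B` at `η := (Lⁿ)⁻¹`, `σ = LʲL⁻ⁿ` -/

section ScaleN

variable {𝔸 : Type*} [NormedRing 𝔸] [NormedAlgebra ℂ 𝔸] [CompleteSpace 𝔸]

/-- The scale letter: `Lʲ·(Lⁿ)⁻¹ = L^{(j:ℝ) − n}` for `L > 0` — the `σ = LʲL⁻ⁿ` of [III] in the rpow shape the §3
consumers use (`…Eq349IrrelevantFeed.perPointIrrelevant_of_charts`). [folklore] -/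
private theorem sigma_eq_rpow {L : ℝ} (hL : 0 < L) (j n : ℕ) :
    L ^ j * (L ^ n)⁻¹ = L ^ ((j : ℝ) - n) := by
  rw [Real.rpow_sub hL, Real.rpow_natCast, Real.rpow_natCast, div_eq_mul_inv]

/-- `0 < σ = Lʲ(Lⁿ)⁻¹ ≤ 1` for `L ≥ 1`, `j ≤ n`. [folklore] -/
private theorem sigma_pos_le_one {L : ℝ} (hL : 1 ≤ L) {j n : ℕ} (hjn : j ≤ n) :
    0 < L ^ j * (L ^ n)⁻¹ ∧ L ^ j * (L ^ n)⁻¹ ≤ 1 := by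
  have hL0 : 0 < L := lt_of_lt_of_le one_pos hL
  refine ⟨by positivity, ?_⟩
  rw [← div_eq_mul_inv, div_le_one (by positivity)]
  exact pow_le_pow_right₀ hL hjn

/-- For `0 < σ ≤ 1`, `0 ≤ β₀ ≤ 1` the Hölder factor `θ = σ^{β₀}` satisfies `σ ≤ θ ≤ 1` (the letters `hθx`, `hθ1` of
`…B12Ineq418Flat.ineq418_flat_scaled` and `hσθ`, `hθ` of `…B14.Eq366Irrelevant.irrelevant366_le_selfAdjoint`).
[folklore] -/
private theorem holderTheta_bounds {σ β₀ : ℝ} (hσ : 0 < σ) (hσ1 : σ ≤ 1) (hβ0 : 0 ≤ β₀) (hβ1 : β₀ ≤ 1) :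
    σ ≤ σ ^ β₀ ∧ σ ^ β₀ ≤ 1 := by
  refine ⟨?_, Real.rpow_le_one hσ.le hσ1 hβ0⟩
  calc σ = σ ^ (1 : ℝ) := (Real.rpow_one σ).symm
    _ ≤ σ ^ β₀ := Real.rpow_le_rpow_of_exponent_ge hσ hσ1 hβ1

/-- **The size of `B` «in the L⁻ⁿ-scale»**: for `B_μ(x) = ζ̃(x)Q_{j,μ}(L⁻ⁿA, x)` with `sup ‖A‖ ≤ a` ((2.38):
`Lⁿξ|A| < BCMα_{0,n}`), `|ζ̃(x)| ≤ 1`, `L ≥ 2` and b07's smallness `C₃LʲL⁻ⁿa ≤ 1`: `‖B_μ(x)‖ ≤ 2a·LʲL⁻ⁿ` — [I] p. 277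
«|B| < O(1)Lʲη» with η replaced by L⁻ⁿ ((131) of [7] via `…B12Ineq417Flat.norm_logIter_le`).
[cite: Balaban1988Convergent, p.276; Balaban1987RG1, p.277] -/
theorem norm_locB_scaleN (ζ : B7Prop1Explicit.Site d → ℝ) (L : ℕ) (hL : 2 ≤ L)
    (A : B7Prop1Explicit.Site d → Fin d → 𝔸) (j n : ℕ) (x : B7Prop1Explicit.Site d) (μ : Fin d) {η a : ℝ}
    (hη : η = ((L : ℝ) ^ n)⁻¹) (ha : 0 ≤ a)
    (hk : C3 d L * ((L : ℝ) ^ j * (η * a)) ≤ 1) (hA : ∀ y κ, ‖A y κ‖ ≤ a) (hζ0 : |ζ x| ≤ 1) :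
    ‖locB ζ L ((η : ℂ) • A) j x μ‖ ≤ 2 * a * ((L : ℝ) ^ j * ((L : ℝ) ^ n)⁻¹) := by
  have hL0 : (0 : ℝ) < L := by exact_mod_cast lt_of_lt_of_le (by norm_num) hL
  have hηpos : 0 < η := by rw [hη]; positivity
  have hηn : ‖(η : ℂ)‖ = η := by rw [Complex.norm_real, Real.norm_of_nonneg hηpos.le]
  have hB : ∀ y κ, ‖((η : ℂ) • A) y κ‖ ≤ η * a := fun y κ => by
    rw [Pi.smul_apply, Pi.smul_apply, norm_smul, hηn]
    exact mul_le_mul_of_nonneg_left (hA y κ) hηpos.le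
  have hQ := norm_logIter_le L hL ((η : ℂ) • A) j (by positivity) hk hB x μ
  rw [locB, norm_smul, Real.norm_eq_abs]
  calc |ζ x| * ‖B7Prop4Flat.logIter L ((η : ℂ) • A) j x μ‖ ≤ 1 * (2 * ((L : ℝ) ^ j * (η * a))) :=
        mul_le_mul hζ0 hQ (norm_nonneg _) zero_le_one
    _ = 2 * a * ((L : ℝ) ^ j * ((L : ℝ) ^ n)⁻¹) := by rw [hη]; ring

/-- **(I.4.17) «with η replaced by L⁻ⁿ»** ([III] p. 276): for `B_μ = ζ̃·Q_{j,μ}(L⁻ⁿA)` on the unit lattice `T₁^{(j)}`,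
under the (2.38)-shaped sizes `sup ‖A‖ ≤ a`, fine differences `‖A(y + e_ν) − A(y)‖ ≤ L⁻ⁿa′`, the profile letters
`|ζ̃| ≤ 1`, `|ζ̃(x + e_ν) − ζ̃(x)| ≤ c₁·LʲL⁻ⁿ`, `L ≥ 2` and `C₃LʲL⁻ⁿa ≤ 1`:
`‖(∂_νB_μ)(x)‖ ≤ (2c₁a + 4da′)·(LʲL⁻ⁿ)²` — `…B12Ineq417Flat.ineq417_flat_scaled` at `η := (Lⁿ)⁻¹`, the factor
`1 + C₃Lʲηa ≤ 2`. [cite: Balaban1988Convergent, p.276; Balaban1987RG1, (4.17) p.285] -/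
theorem ineq417_scaleN (ζ : B7Prop1Explicit.Site d → ℝ) (L : ℕ) (hL : 2 ≤ L)
    (A : B7Prop1Explicit.Site d → Fin d → 𝔸) (j n : ℕ) (ν : Fin d) (x : B7Prop1Explicit.Site d) (μ : Fin d)
    {η a a' c₁ : ℝ} (hη : η = ((L : ℝ) ^ n)⁻¹) (ha : 0 ≤ a)
    (hk : C3 d L * ((L : ℝ) ^ j * (η * a)) ≤ 1) (hA : ∀ y κ, ‖A y κ‖ ≤ a)
    (hA' : ∀ y κ, ‖A (y + e ν) κ - A y κ‖ ≤ η * a') (hζ0 : |ζ x| ≤ 1)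
    (hζ1 : |ζ (x + e ν) - ζ x| ≤ c₁ * ((L : ℝ) ^ j * η)) :
    ‖dlocB ζ L ((η : ℂ) • A) j ν x μ‖ ≤ (2 * c₁ * a + 4 * d * a') * ((L : ℝ) ^ j * ((L : ℝ) ^ n)⁻¹) ^ 2 := by
  have hL0 : (0 : ℝ) < L := by exact_mod_cast lt_of_lt_of_le (by norm_num) hL
  have hηpos : 0 < η := by rw [hη]; positivity
  have ha'0 : 0 ≤ a' := by
    have h := le_trans (norm_nonneg _) (hA' 0 μ)
    nlinarith
  have h := ineq417_flat_scaled ζ L hL A j ν x μ hηpos ha hk hA hA' hζ0 hζ1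
  rw [← hη]
  refine h.trans (mul_le_mul_of_nonneg_right ?_ (sq_nonneg _))
  have h2 : 2 * (d : ℝ) * (1 + C3 d L * ((L : ℝ) ^ j * (η * a))) * a' ≤ 2 * d * 2 * a' := by
    have : 1 + C3 d L * ((L : ℝ) ^ j * (η * a)) ≤ 2 := by linarith
    have hd : (0 : ℝ) ≤ 2 * d := by positivity
    nlinarith [mul_nonneg hd ha'0]
  linarith

/-- **(I.4.18) «with η replaced by L⁻ⁿ»** ([III] p. 276; p. 280 «(I.3.32) in the L⁻ⁿ-scale»): with, in addition to
the letters of `ineq417_scaleN` in both directions `λ, ν`, the HÖLDER letter of (I.3.32) at scale `n` — the coarse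
variation of the fine `ν`-gradient across `Lʲe_λ` is `≤ L⁻ⁿ·a″θ`, `LʲL⁻ⁿ ≤ θ ≤ 1` (`θ = (LʲL⁻ⁿ)^{β₀}`) — the mixed
second profile letter `|ΔΔζ̃| ≤ c₂(LʲL⁻ⁿ)²` and b07's smallness `C₃LʲL⁻ⁿ(2a + 4LʲL⁻ⁿa′) ≤ 1`:
`‖(∂_λ∂_νB_μ)(x)‖ ≤ (4da″ + 32C₃a′² + 8dc₁a′ + 2c₂a)·(LʲL⁻ⁿ)²θ` — `…B12Ineq418Flat.ineq418_flat_scaled` at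
`η := (Lⁿ)⁻¹`. [cite: Balaban1988Convergent, p.276; Balaban1987RG1, (4.18) p.285] -/
theorem ineq418_scaleN (ζ : B7Prop1Explicit.Site d → ℝ) (L : ℕ) (hL : 2 ≤ L)
    (A : B7Prop1Explicit.Site d → Fin d → 𝔸) (j n : ℕ) (lam ν : Fin d) (x : B7Prop1Explicit.Site d) (μ : Fin d)
    {η a a' a'' θ c₁ c₂ : ℝ} (hη : η = ((L : ℝ) ^ n)⁻¹) (ha : 0 ≤ a)
    (ha' : 0 ≤ a') (ha'' : 0 ≤ a'') (hθx : (L : ℝ) ^ j * η ≤ θ) (hθ1 : θ ≤ 1)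
    (hsmall : C3 d L * ((L : ℝ) ^ j * η * (2 * a + 4 * ((L : ℝ) ^ j * η) * a')) ≤ 1)
    (hA : ∀ y κ, ‖A y κ‖ ≤ a) (hALam : ∀ y κ, ‖A (y + e lam) κ - A y κ‖ ≤ η * a')
    (hAν : ∀ y κ, ‖A (y + e ν) κ - A y κ‖ ≤ η * a')
    (hA2 : ∀ y κ, ‖(A (y + ((L : ℤ) ^ j) • e lam + e ν) κ - A (y + ((L : ℤ) ^ j) • e lam) κ)
      - (A (y + e ν) κ - A y κ)‖ ≤ η * (a'' * θ))
    (hζ0 : |ζ x| ≤ 1) (hζLam : |ζ (x + e lam) - ζ x| ≤ c₁ * ((L : ℝ) ^ j * η))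
    (hζν : |ζ (x + e ν) - ζ x| ≤ c₁ * ((L : ℝ) ^ j * η))
    (hζ2 : |ζ (x + e lam + e ν) - ζ (x + e lam) - ζ (x + e ν) + ζ x| ≤ c₂ * ((L : ℝ) ^ j * η) ^ 2) :
    ‖ddlocB ζ L ((η : ℂ) • A) j lam ν x μ‖
      ≤ (4 * d * a'' + 32 * C3 d L * a' ^ 2 + 8 * d * c₁ * a' + 2 * c₂ * a)
          * ((L : ℝ) ^ j * ((L : ℝ) ^ n)⁻¹) ^ 2 * θ := by
  have hL0 : (0 : ℝ) < L := by exact_mod_cast lt_of_lt_of_le (by norm_num) hL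
  have hηpos : 0 < η := by rw [hη]; positivity
  have h := ineq418_flat_scaled ζ L hL A j lam ν x μ hηpos ha ha' ha'' hθx hθ1 hsmall hA hALam hAν hA2 hζ0 hζLam
    hζν hζ2
  rw [← hη]
  exact h

end ScaleN

/-! ## §2. Discrete Taylor expansion on `ℤ^d` around a point (folklore) -/

section Taylor

variable {V : Type*} [SeminormedAddCommGroup V]

omit [SeminormedAddCommGroup V] in
/-- One unit step changes one coordinate: `(x + e_i)_k − z_k = (x_k − z_k) + [k = i]`. [folklore] -/
private theorem sub_add_e_apply (x z : B7Prop1Explicit.Site d) (i k : Fin d) :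
    (x + e i) k - z k = (x k - z k) + (if k = i then 1 else 0) := by
  rw [Pi.add_apply, B7Prop1Explicit.e_apply]; ring

omit [SeminormedAddCommGroup V] in
/-- One unit step backwards: `(x − e_i)_k − z_k = (x_k − z_k) − [k = i]`. [folklore] -/
private theorem sub_sub_e_apply (x z : B7Prop1Explicit.Site d) (i k : Fin d) :
    (x - e i) k - z k = (x k - z k) - (if k = i then 1 else 0) := by
  rw [Pi.sub_apply, B7Prop1Explicit.e_apply]; ring

omit [SeminormedAddCommGroup V] in
/-- The ℓ¹-distance to `z` after a unit step towards `z` from below (`x_i < z_i`) drops by one. [folklore] -/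
private theorem l1_step_up {x z : B7Prop1Explicit.Site d} {i : Fin d} (hi : x i < z i) :
    ∑ k, |(x + e i) k - z k| = ∑ k, |x k - z k| - 1 := by
  rw [Fintype.sum_eq_add_sum_compl i, Fintype.sum_eq_add_sum_compl i (fun k => |x k - z k|)]
  have hc : ∑ k ∈ ({i}ᶜ : Finset (Fin d)), |(x + e i) k - z k| = ∑ k ∈ ({i}ᶜ : Finset (Fin d)), |x k - z k| := by
    refine Finset.sum_congr rfl fun k hk => ?_
    have hki : k ≠ i := by simpa using hk
    rw [sub_add_e_apply, if_neg hki, add_zero]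
  rw [hc, sub_add_e_apply, if_pos rfl, abs_of_nonpos (by omega), abs_of_neg (by omega)]
  ring

omit [SeminormedAddCommGroup V] in
/-- The ℓ¹-distance to `z` after a unit step towards `z` from above (`z_i < x_i`) drops by one. [folklore] -/
private theorem l1_step_down {x z : B7Prop1Explicit.Site d} {i : Fin d} (hi : z i < x i) :
    ∑ k, |(x - e i) k - z k| = ∑ k, |x k - z k| - 1 := by
  rw [Fintype.sum_eq_add_sum_compl i, Fintype.sum_eq_add_sum_compl i (fun k => |x k - z k|)]
  have hc : ∑ k ∈ ({i}ᶜ : Finset (Fin d)), |(x - e i) k - z k| = ∑ k ∈ ({i}ᶜ : Finset (Fin d)), |x k - z k| := by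
    refine Finset.sum_congr rfl fun k hk => ?_
    have hki : k ≠ i := by simpa using hk
    rw [sub_sub_e_apply, if_neg hki, sub_zero]
  rw [hc, sub_sub_e_apply, if_pos rfl, abs_of_nonneg (by omega), abs_of_pos (by omega)]
  ring

omit [SeminormedAddCommGroup V] in
/-- A point at positive ℓ¹-distance from `z` differs from `z` in some coordinate. [folklore] -/
private theorem exists_ne_of_l1_pos {x z : B7Prop1Explicit.Site d} (h : 0 < ∑ k, |x k - z k|) : ∃ i, x i ≠ z i := by
  by_contra hcon
  push Not at hcon
  have : ∑ k, |x k - z k| = 0 := Finset.sum_eq_zero fun k _ => by simp [hcon k]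
  omega

omit [SeminormedAddCommGroup V] in
/-- A point at ℓ¹-distance `0` from `z` is `z`. [folklore] -/
private theorem eq_of_l1_zero {x z : B7Prop1Explicit.Site d} (h : ∑ k, |x k - z k| = 0) : x = z := by
  funext k
  have hk := (Finset.sum_eq_zero_iff_of_nonneg fun k _ => abs_nonneg (x k - z k)).mp h k (Finset.mem_univ k)
  have := abs_eq_zero.mp hk
  omega

/-- **First-order discrete Taylor (telescoping along lattice paths)**: if all unit differences of `f : ℤ^d → V` are
`≤ s₁`, then `‖f(x) − f(z)‖ ≤ |x − z|₁·s₁` — the lattice calculus behind «we move the factors B to the point z instead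
of the point x» (p. 280) and (I.4.23). [cite: Balaban1988Convergent, (3.49) p.280] (elementary API for the relocation
to `z`; our proof) -/
theorem norm_sub_le_l1dist_mul (f : B7Prop1Explicit.Site d → V) {s₁ : ℝ}
    (h1 : ∀ y ν, ‖f (y + e ν) - f y‖ ≤ s₁) (x z : B7Prop1Explicit.Site d) :
    ‖f x - f z‖ ≤ ((∑ k, |x k - z k| : ℤ) : ℝ) * s₁ := by
  suffices H : ∀ N : ℕ, ∀ x : B7Prop1Explicit.Site d, ∑ k, |x k - z k| = N → ‖f x - f z‖ ≤ (N : ℝ) * s₁ by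
    have hnn : 0 ≤ ∑ k, |x k - z k| := Finset.sum_nonneg fun k _ => abs_nonneg _
    have h := H (∑ k, |x k - z k|).toNat x (Int.toNat_of_nonneg hnn).symm
    rwa [show (((∑ k, |x k - z k|).toNat : ℕ) : ℝ) = ((∑ k, |x k - z k| : ℤ) : ℝ) by
      exact_mod_cast Int.toNat_of_nonneg hnn] at h
  intro N
  induction N with
  | zero =>
    intro x hx
    have hxz : x = z := eq_of_l1_zero (by exact_mod_cast hx)
    rw [hxz]
    simp
  | succ N ih =>
    intro x hx
    obtain ⟨i, hi⟩ := exists_ne_of_l1_pos (x := x) (z := z) (by rw [hx]; positivity)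
    rcases lt_or_gt_of_ne hi with hlt | hgt
    · -- step up: `x + e_i` is closer to `z`
      have hd : ∑ k, |(x + e i) k - z k| = N := by rw [l1_step_up hlt, hx]; push_cast; ring
      have hs : ‖f x - f (x + e i)‖ ≤ s₁ := by rw [norm_sub_rev]; exact h1 x i
      calc ‖f x - f z‖ ≤ ‖f x - f (x + e i)‖ + ‖f (x + e i) - f z‖ := norm_sub_le_norm_sub_add_norm_sub _ _ _
        _ ≤ s₁ + (N : ℝ) * s₁ := add_le_add hs (ih _ hd)
        _ = ((N + 1 : ℕ) : ℝ) * s₁ := by push_cast; ring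
    · -- step down: `x − e_i` is closer to `z`, and `x = (x − e_i) + e_i`
      have hd : ∑ k, |(x - e i) k - z k| = N := by rw [l1_step_down hgt, hx]; push_cast; ring
      have hs : ‖f x - f (x - e i)‖ ≤ s₁ := by
        have h := h1 (x - e i) i
        rwa [sub_add_cancel] at h
      calc ‖f x - f z‖ ≤ ‖f x - f (x - e i)‖ + ‖f (x - e i) - f z‖ := norm_sub_le_norm_sub_add_norm_sub _ _ _
        _ ≤ s₁ + (N : ℝ) * s₁ := add_le_add hs (ih _ hd)
        _ = ((N + 1 : ℕ) : ℝ) * s₁ := by push_cast; ring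

variable [NormedSpace ℝ V]

/-- The linear term after one unit step: `Σ_ν((x + e_i)_ν − z_ν)•D_ν = Σ_ν(x_ν − z_ν)•D_ν + D_i`. [folklore] -/
private theorem sum_smul_step_up (x z : B7Prop1Explicit.Site d) (i : Fin d) (D : Fin d → V) :
    ∑ ν, (((x + e i) ν - z ν : ℤ) : ℝ) • D ν = ∑ ν, ((x ν - z ν : ℤ) : ℝ) • D ν + D i := by
  have : ∀ ν, (((x + e i) ν - z ν : ℤ) : ℝ) • D ν
      = ((x ν - z ν : ℤ) : ℝ) • D ν + (if ν = i then D ν else 0) := fun ν => by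
    rw [sub_add_e_apply]; push_cast
    rw [add_smul]; split_ifs <;> simp
  simp_rw [this, Finset.sum_add_distrib, Finset.sum_ite_eq', Finset.mem_univ, if_true]

/-- The linear term after one unit step backwards: `Σ_ν((x − e_i)_ν − z_ν)•D_ν = Σ_ν(x_ν − z_ν)•D_ν − D_i`. [folklore] -/
private theorem sum_smul_step_down (x z : B7Prop1Explicit.Site d) (i : Fin d) (D : Fin d → V) :
    ∑ ν, (((x - e i) ν - z ν : ℤ) : ℝ) • D ν = ∑ ν, ((x ν - z ν : ℤ) : ℝ) • D ν - D i := by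
  have : ∀ ν, (((x - e i) ν - z ν : ℤ) : ℝ) • D ν
      = ((x ν - z ν : ℤ) : ℝ) • D ν - (if ν = i then D ν else 0) := fun ν => by
    rw [sub_sub_e_apply]; push_cast
    rw [sub_smul]; split_ifs <;> simp
  simp_rw [this, Finset.sum_sub_distrib, Finset.sum_ite_eq', Finset.mem_univ, if_true]

/-- **Second-order discrete Taylor**: if all mixed second differences of `f : ℤ^d → V` are `≤ s₂`
(`‖(f(y + e_λ + e_ν) − f(y + e_λ)) − (f(y + e_ν) − f(y))‖ ≤ s₂`), then
`‖f(x) − f(z) − Σ_ν(x − z)_ν•(f(z + e_ν) − f(z))‖ ≤ |x − z|₁²·s₂` (along a lattice path each step's gradient differs from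
the gradient at `z` by at most `|x − z|₁·s₂`, by `norm_sub_le_l1dist_mul` for the gradient) — the second-order
relocation of the factors `B` to the point `z` of (3.49) with the (I.4.18) remainder. [cite: Balaban1988Convergent,
(3.49) p.280] (elementary API for the relocation to `z`; our proof) -/
theorem norm_taylor2_le_l1dist_sq_mul (f : B7Prop1Explicit.Site d → V) {s₂ : ℝ}
    (h2 : ∀ y lam ν, ‖(f (y + e lam + e ν) - f (y + e lam)) - (f (y + e ν) - f y)‖ ≤ s₂)
    (x z : B7Prop1Explicit.Site d) :
    ‖f x - f z - ∑ ν, ((x ν - z ν : ℤ) : ℝ) • (f (z + e ν) - f z)‖ ≤ ((∑ k, |x k - z k| : ℤ) : ℝ) ^ 2 * s₂ := by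
  suffices H : ∀ N : ℕ, ∀ x : B7Prop1Explicit.Site d, ∑ k, |x k - z k| = N →
      ‖f x - f z - ∑ ν, ((x ν - z ν : ℤ) : ℝ) • (f (z + e ν) - f z)‖ ≤ (N : ℝ) ^ 2 * s₂ by
    have hnn : 0 ≤ ∑ k, |x k - z k| := Finset.sum_nonneg fun k _ => abs_nonneg _
    have h := H (∑ k, |x k - z k|).toNat x (Int.toNat_of_nonneg hnn).symm
    rwa [show (((∑ k, |x k - z k|).toNat : ℕ) : ℝ) = ((∑ k, |x k - z k| : ℤ) : ℝ) by
      exact_mod_cast Int.toNat_of_nonneg hnn] at h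
  intro N
  induction N with
  | zero =>
    intro x hx
    have hxz : x = z := eq_of_l1_zero (by exact_mod_cast hx)
    rw [hxz]
    simp
  | succ N ih =>
    intro x hx
    obtain ⟨i, hi⟩ := exists_ne_of_l1_pos (x := x) (z := z) (by rw [hx]; positivity)
    have hs₂ : 0 ≤ s₂ := le_trans (norm_nonneg _) (h2 z i i)
    -- the `i`-gradient `g(y) = f(y + e_i) − f(y)` has unit differences `≤ s₂`
    have hg : ∀ y ν, ‖(fun y => f (y + e i) - f y) (y + e ν) - (fun y => f (y + e i) - f y) y‖ ≤ s₂ :=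
      fun y ν => h2 y ν i
    rcases lt_or_gt_of_ne hi with hlt | hgt
    · -- step up: `x' = x + e_i` is closer to `z`; `x = x' − e_i`
      have hd : ∑ k, |(x + e i) k - z k| = N := by rw [l1_step_up hlt, hx]; push_cast; ring
      have hT1 : ‖(f (x + e i) - f x) - (f (z + e i) - f z)‖ ≤ ((N : ℝ) + 1) * s₂ := by
        have h := norm_sub_le_l1dist_mul (fun y => f (y + e i) - f y) hg x z
        rw [hx] at h
        push_cast at h
        exact h
      have key : f x - f z - ∑ ν, ((x ν - z ν : ℤ) : ℝ) • (f (z + e ν) - f z)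
          = (f (x + e i) - f z - ∑ ν, (((x + e i) ν - z ν : ℤ) : ℝ) • (f (z + e ν) - f z))
            - ((f (x + e i) - f x) - (f (z + e i) - f z)) := by
        rw [sum_smul_step_up]; abel
      rw [key]
      calc ‖(f (x + e i) - f z - ∑ ν, (((x + e i) ν - z ν : ℤ) : ℝ) • (f (z + e ν) - f z))
              - ((f (x + e i) - f x) - (f (z + e i) - f z))‖
          ≤ ‖f (x + e i) - f z - ∑ ν, (((x + e i) ν - z ν : ℤ) : ℝ) • (f (z + e ν) - f z)‖
              + ‖(f (x + e i) - f x) - (f (z + e i) - f z)‖ := norm_sub_le _ _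
        _ ≤ (N : ℝ) ^ 2 * s₂ + ((N : ℝ) + 1) * s₂ := add_le_add (ih _ hd) hT1
        _ ≤ ((N + 1 : ℕ) : ℝ) ^ 2 * s₂ := by push_cast; nlinarith
    · -- step down: `x' = x − e_i` is closer to `z`; `x = x' + e_i`
      have hd : ∑ k, |(x - e i) k - z k| = N := by rw [l1_step_down hgt, hx]; push_cast; ring
      have hxe : x - e i + e i = x := sub_add_cancel x (e i)
      have hT1 : ‖(f (x - e i + e i) - f (x - e i)) - (f (z + e i) - f z)‖ ≤ (N : ℝ) * s₂ := by
        have h := norm_sub_le_l1dist_mul (fun y => f (y + e i) - f y) hg (x - e i) z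
        rw [hd] at h
        push_cast at h
        exact h
      have key : f x - f z - ∑ ν, ((x ν - z ν : ℤ) : ℝ) • (f (z + e ν) - f z)
          = (f (x - e i) - f z - ∑ ν, (((x - e i) ν - z ν : ℤ) : ℝ) • (f (z + e ν) - f z))
            + ((f (x - e i + e i) - f (x - e i)) - (f (z + e i) - f z)) := by
        rw [sum_smul_step_down, hxe]; abel
      rw [key]
      calc ‖(f (x - e i) - f z - ∑ ν, (((x - e i) ν - z ν : ℤ) : ℝ) • (f (z + e ν) - f z))
              + ((f (x - e i + e i) - f (x - e i)) - (f (z + e i) - f z))‖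
          ≤ ‖f (x - e i) - f z - ∑ ν, (((x - e i) ν - z ν : ℤ) : ℝ) • (f (z + e ν) - f z)‖
              + ‖(f (x - e i + e i) - f (x - e i)) - (f (z + e i) - f z)‖ := norm_add_le _ _
        _ ≤ (N : ℝ) ^ 2 * s₂ + (N : ℝ) * s₂ := add_le_add (ih _ hd) hT1
        _ ≤ ((N + 1 : ℕ) : ℝ) ^ 2 * s₂ := by push_cast; nlinarith

end Taylor

/-! ## §3. The four pieces of `…Eq349IrrelevantFeed.perPointIrrelevant_of_charts` on the window of `z` -/

section Pieces

variable {V : Type*} [SeminormedAddCommGroup V] [NormedSpace ℝ V]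

/-- `‖Σ_ν c_ν•v_ν‖ ≤ R·M` for integer coefficients with `Σ|c_ν| ≤ R` and `‖v_ν‖ ≤ M`, `M ≥ 0` (the linear pieces
`λ_z`, `ℓ` on a window of ℓ¹-radius `R`). [folklore] -/
private theorem norm_sum_zsmul_le {ι' : Type*} [Fintype ι'] (c : ι' → ℤ) (v : ι' → V) {M R : ℝ} (hM : 0 ≤ M)
    (hv : ∀ i, ‖v i‖ ≤ M) (hc : ((∑ i, |c i| : ℤ) : ℝ) ≤ R) :
    ‖∑ i, ((c i : ℤ) : ℝ) • v i‖ ≤ R * M := by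
  calc ‖∑ i, ((c i : ℤ) : ℝ) • v i‖ ≤ ∑ i, ‖((c i : ℤ) : ℝ) • v i‖ := norm_sum_le _ _
    _ ≤ ∑ i, ((|c i| : ℤ) : ℝ) * M := Finset.sum_le_sum fun i _ => by
        rw [norm_smul, Real.norm_eq_abs, Int.cast_abs]
        exact mul_le_mul_of_nonneg_left (hv i) (abs_nonneg _)
    _ = ((∑ i, |c i| : ℤ) : ℝ) * M := by push_cast; rw [Finset.sum_mul]
    _ ≤ R * M := mul_le_mul_of_nonneg_right hc hM

variable {𝔸 : Type*} [NormedRing 𝔸] [NormedAlgebra ℂ 𝔸] [CompleteSpace 𝔸] {T : Type*} [Fintype T]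

/-- **Piece `c = B(z)`** (the constant part of the field around `z`): as an element of the consumer's field space
`Fin d → T → 𝔸` (directions × window), `‖c‖ ≤ 2a·LʲL⁻ⁿ` (`norm_locB_scaleN`).
[cite: Balaban1988Convergent, p.280; Balaban1987RG1, (4.16) p.285] -/
theorem norm_piece_c_le (ζ : B7Prop1Explicit.Site d → ℝ) (L : ℕ) (hL : 2 ≤ L)
    (A : B7Prop1Explicit.Site d → Fin d → 𝔸) (j n : ℕ) (z : B7Prop1Explicit.Site d) {η a : ℝ}
    (hη : η = ((L : ℝ) ^ n)⁻¹) (ha : 0 ≤ a) (hk : C3 d L * ((L : ℝ) ^ j * (η * a)) ≤ 1)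
    (hA : ∀ y κ, ‖A y κ‖ ≤ a) (hζ0 : |ζ z| ≤ 1) :
    ‖(fun (μ : Fin d) (_ : T) => locB ζ L ((η : ℂ) • A) j z μ)‖ ≤ 2 * a * ((L : ℝ) ^ j * ((L : ℝ) ^ n)⁻¹) := by
  have hL0 : (0 : ℝ) < L := by exact_mod_cast lt_of_lt_of_le (by norm_num) hL
  have hσ0 : 0 ≤ 2 * a * ((L : ℝ) ^ j * ((L : ℝ) ^ n)⁻¹) := by positivity
  refine (pi_norm_le_iff_of_nonneg hσ0).2 fun μ => (pi_norm_le_iff_of_nonneg hσ0).2 fun _ => ?_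
  exact norm_locB_scaleN ζ L hL A j n z μ hη ha hk hA hζ0

/-- **Piece `λ_z`** — the linear gauge function `λ_z(x) = Σ_ν(x_ν − z_ν)B_ν(z)` of (I.4.23) (`∂_μλ_z = B_μ(z)`), read
on a window `ι : T → ℤ^d` of ℓ¹-radius `R` about `z`: `‖λ_z‖ ≤ R·2a·LʲL⁻ⁿ`.
[cite: Balaban1987RG1, (4.23) p.286; Balaban1988Convergent, p.280] -/
theorem norm_piece_lam_le (ζ : B7Prop1Explicit.Site d → ℝ) (L : ℕ) (hL : 2 ≤ L)
    (A : B7Prop1Explicit.Site d → Fin d → 𝔸) (j n : ℕ) (z : B7Prop1Explicit.Site d) {η a : ℝ}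
    (hη : η = ((L : ℝ) ^ n)⁻¹) (ha : 0 ≤ a) (hk : C3 d L * ((L : ℝ) ^ j * (η * a)) ≤ 1)
    (hA : ∀ y κ, ‖A y κ‖ ≤ a) (hζ0 : |ζ z| ≤ 1) (ι : T → B7Prop1Explicit.Site d) {R : ℝ} (hR : 0 ≤ R)
    (hι : ∀ t, ((∑ k, |ι t k - z k| : ℤ) : ℝ) ≤ R) :
    ‖(fun t : T => ∑ ν, ((ι t ν - z ν : ℤ) : ℝ) • locB ζ L ((η : ℂ) • A) j z ν)‖
      ≤ R * (2 * a * ((L : ℝ) ^ j * ((L : ℝ) ^ n)⁻¹)) := by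
  have hL0 : (0 : ℝ) < L := by exact_mod_cast lt_of_lt_of_le (by norm_num) hL
  have hσ0 : 0 ≤ 2 * a * ((L : ℝ) ^ j * ((L : ℝ) ^ n)⁻¹) := by positivity
  refine (pi_norm_le_iff_of_nonneg (mul_nonneg hR hσ0)).2 fun t => ?_
  exact norm_sum_zsmul_le (fun ν => ι t ν - z ν) _ hσ0 (fun ν => norm_locB_scaleN ζ L hL A j n z ν hη ha hk hA hζ0)
    (hι t)

/-- **Piece `ℓ`** — the linear part `ℓ(x) = Σ_ν(x_ν − z_ν)(∂_νB)(z)` of the field around `z`, read on a window of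
ℓ¹-radius `R`: `‖ℓ‖ ≤ R·(2c₁a + 4da′)·(LʲL⁻ⁿ)²` ((I.4.17) with η replaced by L⁻ⁿ, `ineq417_scaleN`).
[cite: Balaban1988Convergent, p.276; Balaban1987RG1, (4.17) p.285] -/
theorem norm_piece_ell_le (ζ : B7Prop1Explicit.Site d → ℝ) (L : ℕ) (hL : 2 ≤ L)
    (A : B7Prop1Explicit.Site d → Fin d → 𝔸) (j n : ℕ) (z : B7Prop1Explicit.Site d) {η a a' c₁ : ℝ}
    (hη : η = ((L : ℝ) ^ n)⁻¹) (ha : 0 ≤ a) (ha' : 0 ≤ a') (hc₁ : 0 ≤ c₁)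
    (hk : C3 d L * ((L : ℝ) ^ j * (η * a)) ≤ 1)
    (hA : ∀ y κ, ‖A y κ‖ ≤ a) (hA' : ∀ y ν κ, ‖A (y + e ν) κ - A y κ‖ ≤ η * a') (hζ0 : ∀ y, |ζ y| ≤ 1)
    (hζ1 : ∀ y ν, |ζ (y + e ν) - ζ y| ≤ c₁ * ((L : ℝ) ^ j * η))
    (ι : T → B7Prop1Explicit.Site d) {R : ℝ} (hR : 0 ≤ R) (hι : ∀ t, ((∑ k, |ι t k - z k| : ℤ) : ℝ) ≤ R) :
    ‖(fun (μ : Fin d) (t : T) => ∑ ν, ((ι t ν - z ν : ℤ) : ℝ) • dlocB ζ L ((η : ℂ) • A) j ν z μ)‖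
      ≤ R * ((2 * c₁ * a + 4 * d * a') * ((L : ℝ) ^ j * ((L : ℝ) ^ n)⁻¹) ^ 2) := by
  have hL0 : (0 : ℝ) < L := by exact_mod_cast lt_of_lt_of_le (by norm_num) hL
  have hM : 0 ≤ (2 * c₁ * a + 4 * d * a') * ((L : ℝ) ^ j * ((L : ℝ) ^ n)⁻¹) ^ 2 := by positivity
  refine (pi_norm_le_iff_of_nonneg (mul_nonneg hR hM)).2 fun μ =>
    (pi_norm_le_iff_of_nonneg (mul_nonneg hR hM)).2 fun t => ?_
  exact norm_sum_zsmul_le (fun ν => ι t ν - z ν) _ hM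
    (fun ν => ineq417_scaleN ζ L hL A j n ν z μ hη ha hk hA (fun y κ => hA' y ν κ) (hζ0 z) (hζ1 z ν)) (hι t)

/-- **Piece `B − c − ℓ`** — the second-order Taylor remainder of the field around `z` on a window of ℓ¹-radius `R`:
`‖B − c − ℓ‖ ≤ R²·(4da″ + 32C₃a′² + 8dc₁a′ + 2c₂a)·(LʲL⁻ⁿ)²θ` ((I.4.18) with η replaced by L⁻ⁿ, `ineq418_scaleN`, and
the discrete Taylor estimate `norm_taylor2_le_l1dist_sq_mul`). [cite: Balaban1988Convergent, p.276, p.280;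
Balaban1987RG1, (4.18) p.285] -/
theorem norm_piece_rem_le (ζ : B7Prop1Explicit.Site d → ℝ) (L : ℕ) (hL : 2 ≤ L)
    (A : B7Prop1Explicit.Site d → Fin d → 𝔸) (j n : ℕ) (z : B7Prop1Explicit.Site d)
    {η a a' a'' θ c₁ c₂ : ℝ} (hη : η = ((L : ℝ) ^ n)⁻¹) (ha : 0 ≤ a) (ha' : 0 ≤ a') (ha'' : 0 ≤ a'')
    (hc₁ : 0 ≤ c₁) (hc₂ : 0 ≤ c₂) (hθx : (L : ℝ) ^ j * η ≤ θ) (hθ1 : θ ≤ 1)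
    (hsmall : C3 d L * ((L : ℝ) ^ j * η * (2 * a + 4 * ((L : ℝ) ^ j * η) * a')) ≤ 1)
    (hA : ∀ y κ, ‖A y κ‖ ≤ a) (hA' : ∀ y ν κ, ‖A (y + e ν) κ - A y κ‖ ≤ η * a')
    (hA2 : ∀ y (lam ν : Fin d) κ, ‖(A (y + ((L : ℤ) ^ j) • e lam + e ν) κ - A (y + ((L : ℤ) ^ j) • e lam) κ)
      - (A (y + e ν) κ - A y κ)‖ ≤ η * (a'' * θ))
    (hζ0 : ∀ y, |ζ y| ≤ 1) (hζ1 : ∀ y ν, |ζ (y + e ν) - ζ y| ≤ c₁ * ((L : ℝ) ^ j * η))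
    (hζ2 : ∀ y (lam ν : Fin d), |ζ (y + e lam + e ν) - ζ (y + e lam) - ζ (y + e ν) + ζ y|
      ≤ c₂ * ((L : ℝ) ^ j * η) ^ 2)
    (ι : T → B7Prop1Explicit.Site d) {R : ℝ} (hι : ∀ t, ((∑ k, |ι t k - z k| : ℤ) : ℝ) ≤ R) :
    ‖(fun (μ : Fin d) (t : T) => locB ζ L ((η : ℂ) • A) j (ι t) μ)
        - (fun (μ : Fin d) (_ : T) => locB ζ L ((η : ℂ) • A) j z μ)
        - (fun (μ : Fin d) (t : T) => ∑ ν, ((ι t ν - z ν : ℤ) : ℝ) • dlocB ζ L ((η : ℂ) • A) j ν z μ)‖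
      ≤ R ^ 2 * ((4 * d * a'' + 32 * C3 d L * a' ^ 2 + 8 * d * c₁ * a' + 2 * c₂ * a)
          * ((L : ℝ) ^ j * ((L : ℝ) ^ n)⁻¹) ^ 2 * θ) := by
  have hL0 : (0 : ℝ) < L := by exact_mod_cast lt_of_lt_of_le (by norm_num) hL
  have hL1 : 1 ≤ L := le_trans (by norm_num) hL
  have hηpos : 0 < η := by rw [hη]; positivity
  have hθ0 : 0 ≤ θ := le_trans (by positivity) hθx
  have hC3 : 0 ≤ C3 d L := (C3_pos d L hL1).le
  have hM : 0 ≤ (4 * d * a'' + 32 * C3 d L * a' ^ 2 + 8 * d * c₁ * a' + 2 * c₂ * a)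
      * ((L : ℝ) ^ j * ((L : ℝ) ^ n)⁻¹) ^ 2 * θ := by positivity
  refine (pi_norm_le_iff_of_nonneg (by positivity)).2 fun μ =>
    (pi_norm_le_iff_of_nonneg (by positivity)).2 fun t => ?_
  simp only [Pi.sub_apply]
  -- second differences of `f = B_μ` on the unit lattice: (I.4.18) at every point
  have h2 : ∀ y (lam ν : Fin d), ‖(locB ζ L ((η : ℂ) • A) j (y + e lam + e ν) μ - locB ζ L ((η : ℂ) • A) j (y + e lam) μ)
      - (locB ζ L ((η : ℂ) • A) j (y + e ν) μ - locB ζ L ((η : ℂ) • A) j y μ)‖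
      ≤ (4 * d * a'' + 32 * C3 d L * a' ^ 2 + 8 * d * c₁ * a' + 2 * c₂ * a)
          * ((L : ℝ) ^ j * ((L : ℝ) ^ n)⁻¹) ^ 2 * θ := by
    intro y lam ν
    have h := ineq418_scaleN ζ L hL A j n lam ν y μ hη ha ha' ha'' hθx hθ1 hsmall hA (fun y κ => hA' y lam κ)
      (fun y κ => hA' y ν κ) (fun y κ => hA2 y lam ν κ) (hζ0 y) (hζ1 y lam) (hζ1 y ν) (hζ2 y lam ν)
    unfold ddlocB dlocB at h
    exact h
  have hT := norm_taylor2_le_l1dist_sq_mul (fun y => locB ζ L ((η : ℂ) • A) j y μ) h2 (ι t) z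
  refine hT.trans (mul_le_mul_of_nonneg_right ?_ hM)
  have h0 : 0 ≤ ((∑ k, |ι t k - z k| : ℤ) : ℝ) := by exact_mod_cast Finset.sum_nonneg fun k _ => abs_nonneg _
  exact pow_le_pow_left₀ h0 (hι t) 2

/-- **The four letters of `…Eq349IrrelevantFeed.perPointIrrelevant_of_charts` in its literal shape** — for the
field `B_μ = ζ̃·Q_{j,μ}(L⁻ⁿA)` read on a window `ι : T → ℤ^d` of ℓ¹-radius `R` about the point `z` of scale `n ≥ j`,
with print's «positive number» `b ∈ [0, 1]` (Hölder exponent `β₀ = 1 − b`, `θ = (L^{j−n})^{1−b}`), under the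
(2.38)-shaped sizes of `A`, the (I.3.32) Hölder letter at scale `n`, the profile letters of `ζ̃` and b07's smallness:
`‖c‖, ‖λ_z‖ ≤ a⋆L^{(j:ℝ)−n}`, `‖ℓ‖ ≤ a⋆(L^{(j:ℝ)−n})²`, `‖B − c − ℓ‖ ≤ a⋆(L^{(j:ℝ)−n})²(L^{(j:ℝ)−n})^{1−b}` with the ONE
letter `a⋆ = 2a(1 + R) + R(2c₁a + 4da′) + R²(4da″ + 32C₃a′² + 8dc₁a′ + 2c₂a)` — the hypotheses `hcn`, `hlam`, `hℓ`,
`hr` of the consumer, from (I.4.16)–(I.4.18) «with η replaced by L⁻ⁿ».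
[cite: Balaban1988Convergent, p.276, p.280; Balaban1987RG1, (4.16)–(4.18) p.285] -/
theorem pieces_printedShape (ζ : B7Prop1Explicit.Site d → ℝ) (L : ℕ) (hL : 2 ≤ L)
    (A : B7Prop1Explicit.Site d → Fin d → 𝔸) {j n : ℕ} (hjn : j ≤ n) (z : B7Prop1Explicit.Site d)
    {η a a' a'' b c₁ c₂ : ℝ} (hη : η = ((L : ℝ) ^ n)⁻¹) (ha : 0 ≤ a) (ha' : 0 ≤ a') (ha'' : 0 ≤ a'')
    (hb0 : 0 ≤ b) (hb1 : b ≤ 1) (hc₁ : 0 ≤ c₁) (hc₂ : 0 ≤ c₂)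
    (hsmall : C3 d L * ((L : ℝ) ^ j * η * (2 * a + 4 * ((L : ℝ) ^ j * η) * a')) ≤ 1)
    (hA : ∀ y κ, ‖A y κ‖ ≤ a) (hA' : ∀ y ν κ, ‖A (y + e ν) κ - A y κ‖ ≤ η * a')
    (hA2 : ∀ y (lam ν : Fin d) κ, ‖(A (y + ((L : ℤ) ^ j) • e lam + e ν) κ - A (y + ((L : ℤ) ^ j) • e lam) κ)
      - (A (y + e ν) κ - A y κ)‖ ≤ η * (a'' * ((L : ℝ) ^ ((j : ℝ) - n)) ^ (1 - b)))
    (hζ0 : ∀ y, |ζ y| ≤ 1) (hζ1 : ∀ y ν, |ζ (y + e ν) - ζ y| ≤ c₁ * ((L : ℝ) ^ j * η))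
    (hζ2 : ∀ y (lam ν : Fin d), |ζ (y + e lam + e ν) - ζ (y + e lam) - ζ (y + e ν) + ζ y|
      ≤ c₂ * ((L : ℝ) ^ j * η) ^ 2)
    (ι : T → B7Prop1Explicit.Site d) {R : ℝ} (hR : 0 ≤ R) (hι : ∀ t, ((∑ k, |ι t k - z k| : ℤ) : ℝ) ≤ R) :
    ‖(fun (μ : Fin d) (_ : T) => locB ζ L ((η : ℂ) • A) j z μ)‖
        ≤ (2 * a * (1 + R) + R * (2 * c₁ * a + 4 * d * a')
            + R ^ 2 * (4 * d * a'' + 32 * C3 d L * a' ^ 2 + 8 * d * c₁ * a' + 2 * c₂ * a)) * (L : ℝ) ^ ((j : ℝ) - n)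
      ∧ ‖(fun t : T => ∑ ν, ((ι t ν - z ν : ℤ) : ℝ) • locB ζ L ((η : ℂ) • A) j z ν)‖
        ≤ (2 * a * (1 + R) + R * (2 * c₁ * a + 4 * d * a')
            + R ^ 2 * (4 * d * a'' + 32 * C3 d L * a' ^ 2 + 8 * d * c₁ * a' + 2 * c₂ * a)) * (L : ℝ) ^ ((j : ℝ) - n)
      ∧ ‖(fun (μ : Fin d) (t : T) => ∑ ν, ((ι t ν - z ν : ℤ) : ℝ) • dlocB ζ L ((η : ℂ) • A) j ν z μ)‖
        ≤ (2 * a * (1 + R) + R * (2 * c₁ * a + 4 * d * a')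
            + R ^ 2 * (4 * d * a'' + 32 * C3 d L * a' ^ 2 + 8 * d * c₁ * a' + 2 * c₂ * a))
          * ((L : ℝ) ^ ((j : ℝ) - n)) ^ 2
      ∧ ‖(fun (μ : Fin d) (t : T) => locB ζ L ((η : ℂ) • A) j (ι t) μ)
          - (fun (μ : Fin d) (_ : T) => locB ζ L ((η : ℂ) • A) j z μ)
          - (fun (μ : Fin d) (t : T) => ∑ ν, ((ι t ν - z ν : ℤ) : ℝ) • dlocB ζ L ((η : ℂ) • A) j ν z μ)‖
        ≤ (2 * a * (1 + R) + R * (2 * c₁ * a + 4 * d * a')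
            + R ^ 2 * (4 * d * a'' + 32 * C3 d L * a' ^ 2 + 8 * d * c₁ * a' + 2 * c₂ * a))
          * ((L : ℝ) ^ ((j : ℝ) - n)) ^ 2 * ((L : ℝ) ^ ((j : ℝ) - n)) ^ (1 - b) := by
  have hL0 : (0 : ℝ) < L := by exact_mod_cast lt_of_lt_of_le (by norm_num) hL
  have hL1 : (1 : ℝ) ≤ L := by exact_mod_cast le_trans (by norm_num) hL
  have hL1' : 1 ≤ L := le_trans (by norm_num) hL
  have hC3 : 0 ≤ C3 d L := (C3_pos d L hL1').le
  -- the scale letter and the Hölder factor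
  have hσ : (L : ℝ) ^ j * ((L : ℝ) ^ n)⁻¹ = (L : ℝ) ^ ((j : ℝ) - n) := sigma_eq_rpow hL0 j n
  have hσx : (L : ℝ) ^ j * η = (L : ℝ) ^ ((j : ℝ) - n) := by rw [hη, hσ]
  obtain ⟨hσpos, hσ1⟩ := sigma_pos_le_one hL1 hjn
  rw [hσ] at hσpos hσ1
  obtain ⟨hθx, hθ1⟩ := holderTheta_bounds hσpos hσ1 (by linarith : 0 ≤ 1 - b) (by linarith : 1 - b ≤ 1)
  -- b07's smallness for the first-order files follows from the (4.18) one
  have hk : C3 d L * ((L : ℝ) ^ j * (η * a)) ≤ 1 := by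
    have hηpos : 0 < η := by rw [hη]; positivity
    have h1 : C3 d L * ((L : ℝ) ^ j * (η * a)) ≤ C3 d L * ((L : ℝ) ^ j * η * (2 * a + 4 * ((L : ℝ) ^ j * η) * a')) := by
      apply mul_le_mul_of_nonneg_left _ hC3
      have : 0 ≤ (L : ℝ) ^ j * η := by positivity
      nlinarith [mul_nonneg this ha, mul_nonneg (mul_nonneg this this) ha']
    exact h1.trans hsmall
  -- the common letter dominates each constant
  have hC₁0 : 0 ≤ 2 * c₁ * a + 4 * d * a' := by positivity
  have hC₂0 : 0 ≤ 4 * d * a'' + 32 * C3 d L * a' ^ 2 + 8 * d * c₁ * a' + 2 * c₂ * a := by positivity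
  have hRC₁ : 0 ≤ R * (2 * c₁ * a + 4 * d * a') := mul_nonneg hR hC₁0
  have hRC₂ : 0 ≤ R ^ 2 * (4 * d * a'' + 32 * C3 d L * a' ^ 2 + 8 * d * c₁ * a' + 2 * c₂ * a) :=
    mul_nonneg (sq_nonneg R) hC₂0
  have hRa : 0 ≤ 2 * a * R := by positivity
  have hstar1 : 2 * a ≤ 2 * a * (1 + R) + R * (2 * c₁ * a + 4 * d * a')
      + R ^ 2 * (4 * d * a'' + 32 * C3 d L * a' ^ 2 + 8 * d * c₁ * a' + 2 * c₂ * a) := by linarith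
  have hstar2 : R * (2 * a) ≤ 2 * a * (1 + R) + R * (2 * c₁ * a + 4 * d * a')
      + R ^ 2 * (4 * d * a'' + 32 * C3 d L * a' ^ 2 + 8 * d * c₁ * a' + 2 * c₂ * a) := by linarith
  have hstar3 : R * (2 * c₁ * a + 4 * d * a') ≤ 2 * a * (1 + R) + R * (2 * c₁ * a + 4 * d * a')
      + R ^ 2 * (4 * d * a'' + 32 * C3 d L * a' ^ 2 + 8 * d * c₁ * a' + 2 * c₂ * a) := by linarith
  have hstar4 : R ^ 2 * (4 * d * a'' + 32 * C3 d L * a' ^ 2 + 8 * d * c₁ * a' + 2 * c₂ * a)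
      ≤ 2 * a * (1 + R) + R * (2 * c₁ * a + 4 * d * a')
      + R ^ 2 * (4 * d * a'' + 32 * C3 d L * a' ^ 2 + 8 * d * c₁ * a' + 2 * c₂ * a) := by linarith
  have hσ2 : 0 ≤ ((L : ℝ) ^ ((j : ℝ) - n)) ^ 2 := sq_nonneg _
  have hσ3 : 0 ≤ ((L : ℝ) ^ ((j : ℝ) - n)) ^ 2 * ((L : ℝ) ^ ((j : ℝ) - n)) ^ (1 - b) :=
    mul_nonneg hσ2 (le_trans hσpos.le hθx)
  refine ⟨?_, ?_, ?_, ?_⟩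
  · have h := norm_piece_c_le (T := T) ζ L hL A j n z hη ha hk hA (hζ0 z)
    rw [hσ] at h
    exact h.trans (mul_le_mul_of_nonneg_right hstar1 hσpos.le)
  · have h := norm_piece_lam_le ζ L hL A j n z hη ha hk hA (hζ0 z) ι hR hι
    rw [hσ, ← mul_assoc] at h
    exact h.trans (mul_le_mul_of_nonneg_right hstar2 hσpos.le)
  · have h := norm_piece_ell_le ζ L hL A j n z hη ha ha' hc₁ hk hA hA' hζ0 hζ1 ι hR hι
    rw [hσ, ← mul_assoc] at h
    exact h.trans (mul_le_mul_of_nonneg_right hstar3 hσ2)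
  · have h := norm_piece_rem_le ζ L hL A j n z hη ha ha' ha'' hc₁ hc₂ (by rw [hσx]; exact hθx) hθ1 hsmall hA hA'
      hA2 hζ0 hζ1 hζ2 ι hι
    rw [hσ] at h
    refine h.trans ?_
    rw [show R ^ 2 * ((4 * d * a'' + 32 * C3 d L * a' ^ 2 + 8 * d * c₁ * a' + 2 * c₂ * a)
        * ((L : ℝ) ^ ((j : ℝ) - n)) ^ 2 * ((L : ℝ) ^ ((j : ℝ) - n)) ^ (1 - b))
        = (R ^ 2 * (4 * d * a'' + 32 * C3 d L * a' ^ 2 + 8 * d * c₁ * a' + 2 * c₂ * a))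
          * (((L : ℝ) ^ ((j : ℝ) - n)) ^ 2 * ((L : ℝ) ^ ((j : ℝ) - n)) ^ (1 - b)) by ring,
      show (2 * a * (1 + R) + R * (2 * c₁ * a + 4 * d * a')
          + R ^ 2 * (4 * d * a'' + 32 * C3 d L * a' ^ 2 + 8 * d * c₁ * a' + 2 * c₂ * a))
          * ((L : ℝ) ^ ((j : ℝ) - n)) ^ 2 * ((L : ℝ) ^ ((j : ℝ) - n)) ^ (1 - b)
        = (2 * a * (1 + R) + R * (2 * c₁ * a + 4 * d * a')
          + R ^ 2 * (4 * d * a'' + 32 * C3 d L * a' ^ 2 + 8 * d * c₁ * a' + 2 * c₂ * a))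
          * (((L : ℝ) ^ ((j : ℝ) - n)) ^ 2 * ((L : ℝ) ^ ((j : ℝ) - n)) ^ (1 - b)) by ring]
    exact mul_le_mul_of_nonneg_right hstar4 hσ3

end Pieces

/-! ## §4. The (3.66) consumer under (2.38) read in j-units and the Hölder letter at scale `n` -/

section Eq366

variable {𝔸 : Type*} [NormedRing 𝔸] [NormedAlgebra ℂ 𝔸] [NormOneClass 𝔸] [CompleteSpace 𝔸]

open Literature.MathematicalPhysics.QuantumFieldTheory.Balaban1983to89.B14.Eq366ActionF2 (plaqF plaqHol)
open Literature.MathematicalPhysics.QuantumFieldTheory.Balaban1983to89.B14.Eq366Irrelevant (irrelevant366_le_selfAdjoint)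

/-- **(3.66)'s irrelevant terms from (2.38) at scale `n`** — `…B14.Eq366Irrelevant.irrelevant366_le_selfAdjoint` with
its three regularity letters SUPPLIED from print's: on the window `{|mᵢ| ≤ N}` of `h_z` in the fine lattice of the unit
`j`-cube (`ξ = (N + 1)⁻¹ = L⁻ʲ`; the `n`-th unit length is `σ⁻¹` `j`-units, `σ = LʲL⁻ⁿ ∈ (0, 1]`), (2.38) READ IN
j-UNITS for the Hermitian bond field `B` of `U_k^u = exp iξB` — `σ⁻¹‖B‖ ≤ c` («Lⁿξ|A| < BCMα_{0,n}») on the closed window,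
`σ⁻²·ξ⁻¹‖B_μ(x + ξe_ν) − B_μ(x)‖ ≤ c` («(Lⁿξ)²|∇^ξA| < BCMα_{0,n}») — and the Hölder member of (I.3.32) «in the L⁻ⁿ-scale»
across the window, `σ⁻²·ξ⁻¹‖∇_νB_μ(x) − ∇_νB_μ(z)‖ ≤ c·σ^{β₀}` (`0 ≤ β₀ ≤ 1`; window diameter `≤ 1` j-unit `= σ`
n-units), plus the smallness `16cσ ≤ N + 1`:
`|A(h_z, U) − ½Σ_{μ<ν} Re τ F²_{μν}(z)| ≤ c₂(4c)·σ⁴·σ^{β₀}`, `c₂(x) = 24x² + 168x³ + 456x⁴ + 156x⁵` — print's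
`O((LʲL⁻ⁿ)^{5−β})` with `β = 1 − β₀`, no letter left but (2.38)'s `c = BCMα_{0,n}` and the Hölder size.
[cite: Balaban1988Convergent, (3.66) p.283, (2.38) p.261, p.280] -/
theorem irrelevant366_le_of_letters238 [StarRing 𝔸] [StarModule ℂ 𝔸] (τ : 𝔸 →L[ℂ] ℂ)
    (htr : ∀ a b : 𝔸, τ (a * b) = τ (b * a)) (hτ1 : τ 1 = 1) (hτn : ∀ a : 𝔸, ‖τ a‖ ≤ ‖a‖)
    (hstar : ∀ a : 𝔸, τ (star a) = starRingEnd ℂ (τ a)) (N : ℕ) (B : (Fin 4 → ℤ) → Fin 4 → 𝔸) {c σ β₀ : ℝ}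
    (hc : 0 ≤ c) (hσ : 0 < σ) (hσ1 : σ ≤ 1) (hβ0 : 0 ≤ β₀) (hβ1 : β₀ ≤ 1) (hs : 16 * (c * σ) ≤ (N : ℝ) + 1)
    (hsa : ∀ m ∈ Fintype.piFinset (fun _ : Fin 4 => Finset.Icc (-((N : ℤ) + 1)) ((N : ℤ) + 1)), ∀ μ,
      IsSelfAdjoint (B m μ))
    (h238a : ∀ m ∈ Fintype.piFinset (fun _ : Fin 4 => Finset.Icc (-((N : ℤ) + 1)) ((N : ℤ) + 1)), ∀ μ,
      σ⁻¹ * ‖B m μ‖ ≤ c)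
    (h238b : ∀ m ∈ Fintype.piFinset (fun _ : Fin 4 => Finset.Icc (-(N : ℤ)) N), ∀ μ ν,
      (σ ^ 2)⁻¹ * (((N : ℝ) + 1) * ‖B (m + Pi.single ν 1) μ - B m μ‖) ≤ c)
    (hHol : ∀ m ∈ Fintype.piFinset (fun _ : Fin 4 => Finset.Icc (-(N : ℤ)) N), ∀ μ ν,
      (σ ^ 2)⁻¹ * (((N : ℝ) + 1) * ‖(B (m + Pi.single ν 1) μ - B m μ) - (B (Pi.single ν 1) μ - B 0 μ)‖)
        ≤ c * σ ^ β₀) :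
    |∑ m ∈ Fintype.piFinset (fun _ : Fin 4 => Finset.Icc (-(N : ℤ)) N),
        (∏ i, (1 - |(m i : ℝ)| / ((N : ℝ) + 1)))
          * ∑ d ∈ Finset.univ.filter (fun d : Fin 4 × Fin 4 => d.1 < d.2),
            (1 - (τ (plaqHol ((N : ℝ) + 1)⁻¹ (B m d.1) (B m d.2) (B (m + Pi.single d.2 1) d.1)
              (B (m + Pi.single d.1 1) d.2))).re)
      - 2⁻¹ * ∑ d ∈ Finset.univ.filter (fun d : Fin 4 × Fin 4 => d.1 < d.2),
          (τ (plaqF ((N : ℝ) + 1)⁻¹ (B 0 d.1) (B 0 d.2) (B (Pi.single d.2 1) d.1)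
            (B (Pi.single d.1 1) d.2) ^ 2)).re|
      ≤ (24 * (4 * c) ^ 2 + 168 * (4 * c) ^ 3 + 456 * (4 * c) ^ 4 + 156 * (4 * c) ^ 5) * σ ^ 4 * σ ^ β₀ := by
  have hN1 : (0 : ℝ) < (N : ℝ) + 1 := by positivity
  obtain ⟨hσθ, hθ1⟩ := holderTheta_bounds hσ hσ1 hβ0 hβ1
  -- the three letters of the consumer, from print's
  have hB : ∀ m ∈ Fintype.piFinset (fun _ : Fin 4 => Finset.Icc (-((N : ℤ) + 1)) ((N : ℤ) + 1)), ∀ μ,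
      ‖B m μ‖ ≤ c * σ := fun m hm μ => by
    have h := mul_le_mul_of_nonneg_left (h238a m hm μ) hσ.le
    rwa [← mul_assoc, mul_inv_cancel₀ hσ.ne', one_mul, mul_comm] at h
  have hD : ∀ m ∈ Fintype.piFinset (fun _ : Fin 4 => Finset.Icc (-(N : ℤ)) N), ∀ μ ν,
      ‖B (m + Pi.single ν 1) μ - B m μ‖ ≤ ((N : ℝ) + 1)⁻¹ * (c * σ ^ 2) := fun m hm μ ν => by
    have hσ2 : 0 < σ ^ 2 := by positivity
    have h := mul_le_mul_of_nonneg_left (h238b m hm μ ν) hσ2.le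
    rw [← mul_assoc, mul_inv_cancel₀ hσ2.ne', one_mul] at h
    rw [le_inv_mul_iff₀' hN1]  -- goal: (N+1) * ‖…‖ ≤ c * σ^2
    linarith
  have hH : ∀ m ∈ Fintype.piFinset (fun _ : Fin 4 => Finset.Icc (-(N : ℤ)) N), ∀ μ ν,
      ‖(B (m + Pi.single ν 1) μ - B m μ) - (B (Pi.single ν 1) μ - B 0 μ)‖
        ≤ ((N : ℝ) + 1)⁻¹ * (c * σ ^ 2 * σ ^ β₀) := fun m hm μ ν => by
    have hσ2 : 0 < σ ^ 2 := by positivity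
    have h := mul_le_mul_of_nonneg_left (hHol m hm μ ν) hσ2.le
    rw [← mul_assoc, mul_inv_cancel₀ hσ2.ne', one_mul] at h
    rw [le_inv_mul_iff₀' hN1]
    linarith
  exact irrelevant366_le_selfAdjoint τ htr hτ1 hτn hstar N B hc hσ hσθ hθ1 hs hsa hB hD hH

end Eq366

/-! ## §5. The (3.49) consumer END TO END at a point of scale `n`: `perPointIrrelevant_of_charts` with its four
letters supplied by §3 -/

section Eq349

open Set Metric NormedSpace
open Literature.MathematicalPhysics.QuantumFieldTheory.Balaban1983to89.B12TreeDecay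
open Literature.MathematicalPhysics.QuantumFieldTheory.Balaban1983to89.B14.Eq349IrrelevantFeed (perPointIrrelevant_of_charts)

variable {𝔸 : Type*} [NormedRing 𝔸] [NormedAlgebra ℂ 𝔸] [CompleteSpace 𝔸] {T : Type*} [Fintype T]
  {𝔄 : Type*} [NormedRing 𝔄] [NormedAlgebra ℝ 𝔄] {F : Type*} [NormedAddCommGroup F] [NormedSpace ℂ F] [CompleteSpace F]

-- (the quadruply nested operator space over the iterated `Pi` type: one more level of pending instance synthesis)
set_option maxSynthPendingDepth 3 in
/-- **The (3.49) irrelevant constituent of the point `z`, from the letters at scale `n`** —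
`…B14.Eq349IrrelevantFeed.perPointIrrelevant_of_charts` (p. 281: «bounded by O((LʲL⁻ⁿ)^{5−β}) exp(−κd_j(X))», summed
over the domains assigned to `z`) with its chart-field pieces `c, λ_z, ℓ, B` TAKEN TO BE the unit-lattice field
`B_μ = ζ̃·Q_{j,μ}(L⁻ⁿA)` read on the window `ι : T → ℤ^d` of ℓ¹-radius `R` about `z` and its Taylor pieces of §3
(hypotheses `hBdef`, `hcdef`, `hℓdef`, `hlamdef`, instantiated by `rfl`), and its four letters `hcn, hlam, hℓ, hr`
DISCHARGED by `pieces_printedShape` from the (2.38)-shaped sizes of `A`, the (I.3.32) Hölder letter at scale `n`, the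
profile letters of `ζ̃`, b07's smallness, for any letter `a ≥ a⋆`: `|Σ_{X∈𝒜} i(X)| ≤ (C·E₀·K₀(c₀, Δ))·(L^{(j:ℝ)−n})^{5−β}`.
Everything else (the cube system, the charts `ℰ_X` with (2.27)(ii)+(iv), the bracket bound, `hi`) is the consumer's,
passed through verbatim. [cite: Balaban1988Convergent, p.281, (3.49) p.280, p.276; Balaban1987RG1, (4.16)–(4.18) p.285] -/
theorem perPointIrrelevant_of_letters
    {Sy : LocDomainSys} (G : CubeSystem Sy) {Δ : ℕ} (hΔ : G.DegreeLE Δ) {c₀ : ℝ} (hV : G.VolumeLeaf c₀) {κ : ℝ}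
    (hκ : kappa₀ c₀ Δ ≤ κ)
    {𝔤 : Type*} [LieRing 𝔤] [LieAlgebra ℝ 𝔤] (eV : 𝔸 ≃ₗ[ℝ] 𝔤) (ρ : 𝔸 →L[ℝ] 𝔄) {α : ℝ} (hα : 0 < α) {E₀ : ℝ}
    (hE₀ : 0 ≤ E₀) {b : ℝ} (hb0 : 0 ≤ b) (hb : ∀ x y : 𝔸, ‖eV.symm ⁅eV x, eV y⁆‖ ≤ b * ‖x‖ * ‖y‖)
    {a : ℝ} {C : ℝ}
    (hC : (3 / 2 : ℝ) * (4 / α) ^ 2 * a ^ 2 + (10 / 3 : ℝ) * (4 / α) ^ 2 * a ^ 3 * b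
          + (9 / 8 : ℝ) * (4 / α) ^ 2 * a ^ 4 * b ^ 2
          + (5 / 2 : ℝ) * (6 / α) ^ 3 * a ^ 3 + (33 / 8 : ℝ) * (6 / α) ^ 3 * a ^ 4 * b
          + (9 / 4 : ℝ) * (8 / α) ^ 4 * a ^ 4 ≤ C)
    (L : ℕ) (hL : 2 ≤ L) {j n : ℕ} (hjn : j ≤ n) {β : ℝ} (hβ0 : 0 ≤ β) (hβ1 : β ≤ 1)
    {𝒜 : Finset Sy.Dom} {cz : G.Cube} (h𝒜 : 𝒜 ⊆ G.above cz)
    (ℰ : Sy.Dom → (Fin d → T → 𝔄) → F)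
    (hf : ∀ X ∈ 𝒜, AnalyticOnNhd ℂ (fun A' : Fin d → T → 𝔸 => ℰ X (fun ν y => exp (ρ (A' ν y)))) (ball 0 α))
    (hS : ∀ X ∈ 𝒜, ∀ A' ∈ ball (0 : Fin d → T → 𝔸) α,
      ‖ℰ X (fun ν y => exp (ρ (A' ν y)))‖ ≤ E₀ * Real.exp (-κ * Sy.dj X))
    -- the letters at scale `n` (§1, §3)
    (ζ : B7Prop1Explicit.Site d → ℝ) (Afine : B7Prop1Explicit.Site d → Fin d → 𝔸) (z : B7Prop1Explicit.Site d)
    {η a₀ a' a'' c₁ c₂ : ℝ} (hη : η = ((L : ℝ) ^ n)⁻¹) (ha₀ : 0 ≤ a₀) (ha' : 0 ≤ a') (ha'' : 0 ≤ a'')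
    (hc₁ : 0 ≤ c₁) (hc₂ : 0 ≤ c₂)
    (hsmall : C3 d L * ((L : ℝ) ^ j * η * (2 * a₀ + 4 * ((L : ℝ) ^ j * η) * a')) ≤ 1)
    (hA : ∀ y κ', ‖Afine y κ'‖ ≤ a₀) (hA' : ∀ y ν κ', ‖Afine (y + e ν) κ' - Afine y κ'‖ ≤ η * a')
    (hA2 : ∀ y (la ν : Fin d) κ', ‖(Afine (y + ((L : ℤ) ^ j) • e la + e ν) κ' - Afine (y + ((L : ℤ) ^ j) • e la) κ')
      - (Afine (y + e ν) κ' - Afine y κ')‖ ≤ η * (a'' * ((L : ℝ) ^ ((j : ℝ) - n)) ^ (1 - β)))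
    (hζ0 : ∀ y, |ζ y| ≤ 1) (hζ1 : ∀ y ν, |ζ (y + e ν) - ζ y| ≤ c₁ * ((L : ℝ) ^ j * η))
    (hζ2 : ∀ y (la ν : Fin d), |ζ (y + e la + e ν) - ζ (y + e la) - ζ (y + e ν) + ζ y|
      ≤ c₂ * ((L : ℝ) ^ j * η) ^ 2)
    (ι : T → B7Prop1Explicit.Site d) {R : ℝ} (hR : 0 ≤ R) (hι : ∀ t, ((∑ k, |ι t k - z k| : ℤ) : ℝ) ≤ R)
    (hastar : 2 * a₀ * (1 + R) + R * (2 * c₁ * a₀ + 4 * d * a')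
      + R ^ 2 * (4 * d * a'' + 32 * C3 d L * a' ^ 2 + 8 * d * c₁ * a' + 2 * c₂ * a₀) ≤ a)
    -- the consumer's pieces ARE the window field and its Taylor pieces
    (lam : T → 𝔸) (c ℓ B : Fin d → T → 𝔸)
    (hBdef : B = fun μ t => locB ζ L ((η : ℂ) • Afine) j (ι t) μ)
    (hcdef : c = fun μ _ => locB ζ L ((η : ℂ) • Afine) j z μ)
    (hℓdef : ℓ = fun μ t => ∑ ν, ((ι t ν - z ν : ℤ) : ℝ) • dlocB ζ L ((η : ℂ) • Afine) j ν z μ)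
    (hlamdef : lam = fun t => ∑ ν, ((ι t ν - z ν : ℤ) : ℝ) • locB ζ L ((η : ℂ) • Afine) j z ν)
    (i : Sy.Dom → ℝ) (hi : ∀ X ∈ 𝒜, |i X| ≤
      ‖fderiv ℝ (fderiv ℝ (fun A' : Fin d → T → 𝔸 => ℰ X (fun ν y => exp (ρ (A' ν y))))) 0 ℓ (B - c - ℓ)
          + (2 : ℝ)⁻¹ • fderiv ℝ (fderiv ℝ (fun A' : Fin d → T → 𝔸 => ℰ X (fun ν y => exp (ρ (A' ν y))))) 0 (B - c - ℓ) (B - c - ℓ)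
          + (3 : ℝ)⁻¹ • fderiv ℝ (fderiv ℝ (fun A' : Fin d → T → 𝔸 => ℰ X (fun ν y => exp (ρ (A' ν y))))) 0 (B - c - ℓ)
              (fun ν y => eV.symm ⁅eV (lam y), eV (c ν y)⁆)
          + (3 : ℝ)⁻¹ • fderiv ℝ (fderiv ℝ (fun A' : Fin d → T → 𝔸 => ℰ X (fun ν y => exp (ρ (A' ν y))))) 0 (B - c)
              (fun ν y => eV.symm ⁅eV (lam y), eV ((B - c) ν y)⁆ - (2 : ℝ)⁻¹ • eV.symm ⁅eV ((B - c) ν y), eV (c ν y)⁆)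
          + (6 : ℝ)⁻¹ • fderiv ℝ (fderiv ℝ (fderiv ℝ (fun A' : Fin d → T → 𝔸 => ℰ X (fun ν y => exp (ρ (A' ν y)))))) 0 B B (B - c - ℓ)
          + (6 : ℝ)⁻¹ • fderiv ℝ (fderiv ℝ (fderiv ℝ (fun A' : Fin d → T → 𝔸 => ℰ X (fun ν y => exp (ρ (A' ν y)))))) 0 ℓ B (B - c)
          + (6 : ℝ)⁻¹ • fderiv ℝ (fderiv ℝ (fun A' : Fin d → T → 𝔸 => ℰ X (fun ν y => exp (ρ (A' ν y))))) 0 ℓ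
              (fun ν y => eV.symm ⁅eV (lam y), eV ((B - c) ν y)⁆ - (2 : ℝ)⁻¹ • eV.symm ⁅eV ((B - c) ν y), eV (c ν y)⁆)
          + (6 : ℝ)⁻¹ • fderiv ℝ (fderiv ℝ (fun A' : Fin d → T → 𝔸 => ℰ X (fun ν y => exp (ρ (A' ν y))))) 0 (B - c)
              (fun ν y => eV.symm ⁅eV (lam y), eV (ℓ ν y)⁆ - (2 : ℝ)⁻¹ • eV.symm ⁅eV (ℓ ν y), eV (c ν y)⁆)
          + (8 : ℝ)⁻¹ • fderiv ℝ (fderiv ℝ (fun A' : Fin d → T → 𝔸 => ℰ X (fun ν y => exp (ρ (A' ν y))))) 0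
              (fun ν y => eV.symm ⁅eV (lam y), eV (c ν y)⁆)
              (fun ν y => eV.symm ⁅eV (lam y), eV ((B - c) ν y)⁆ - (2 : ℝ)⁻¹ • eV.symm ⁅eV ((B - c) ν y), eV (c ν y)⁆)
          + (8 : ℝ)⁻¹ • fderiv ℝ (fderiv ℝ (fun A' : Fin d → T → 𝔸 => ℰ X (fun ν y => exp (ρ (A' ν y))))) 0 (B - c)
              (fun ν y => eV.symm ⁅eV (lam y), eV (eV.symm ⁅eV (lam y), eV (c ν y)⁆)⁆
                - (2 : ℝ)⁻¹ • eV.symm ⁅eV (eV.symm ⁅eV (lam y), eV (c ν y)⁆), eV (c ν y)⁆)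
          + (8 : ℝ)⁻¹ • fderiv ℝ (fderiv ℝ (fderiv ℝ (fun A' : Fin d → T → 𝔸 => ℰ X (fun ν y => exp (ρ (A' ν y)))))) 0
              (fun ν y => eV.symm ⁅eV (lam y), eV (c ν y)⁆) B (B - c)
          + (8 : ℝ)⁻¹ • fderiv ℝ (fderiv ℝ (fderiv ℝ (fun A' : Fin d → T → 𝔸 => ℰ X (fun ν y => exp (ρ (A' ν y)))))) 0 B B
              (fun ν y => eV.symm ⁅eV (lam y), eV ((B - c) ν y)⁆ - (2 : ℝ)⁻¹ • eV.symm ⁅eV ((B - c) ν y), eV (c ν y)⁆)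
          - (48 : ℝ)⁻¹ • fderiv ℝ (fderiv ℝ (fun A' : Fin d → T → 𝔸 => ℰ X (fun ν y => exp (ρ (A' ν y))))) 0 B
              (fun ν y => eV.symm ⁅eV (B ν y), eV (eV.symm ⁅eV ((B - c) ν y), eV (c ν y)⁆)⁆)
          + (24 : ℝ)⁻¹ • fderiv ℝ (fderiv ℝ (fderiv ℝ (fderiv ℝ (fun A' : Fin d → T → 𝔸 => ℰ X (fun ν y => exp (ρ (A' ν y))))))) 0 B B B (B - c)‖) :
    |∑ X ∈ 𝒜, i X| ≤ (C * E₀ * K₀ c₀ Δ) * ((L : ℝ) ^ ((j : ℝ) - n)) ^ ((5 : ℝ) - β) := by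
  have hL0 : (0 : ℝ) < L := by exact_mod_cast lt_of_lt_of_le (by norm_num) hL
  have hL1 : (1 : ℝ) ≤ L := by exact_mod_cast le_trans (by norm_num) hL
  -- the four letters from §3, at the letter `a⋆`, then weakened to `a ≥ a⋆`
  obtain ⟨h1, h2, h3, h4⟩ := pieces_printedShape (T := T) ζ L hL Afine hjn z hη ha₀ ha' ha'' hβ0 hβ1 hc₁ hc₂ hsmall
    hA hA' hA2 hζ0 hζ1 hζ2 ι hR hι
  have hσ0 : 0 ≤ (L : ℝ) ^ ((j : ℝ) - n) := (Real.rpow_pos_of_pos hL0 _).le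
  have hθ0 : 0 ≤ ((L : ℝ) ^ ((j : ℝ) - n)) ^ (1 - β) := (Real.rpow_pos_of_pos (Real.rpow_pos_of_pos hL0 _) _).le
  have ha : 0 ≤ a := by
    have hL1' : 1 ≤ L := le_trans (by norm_num) hL
    have hC3 : 0 ≤ C3 d L := (C3_pos d L hL1').le
    have : 0 ≤ 2 * a₀ * (1 + R) + R * (2 * c₁ * a₀ + 4 * d * a')
        + R ^ 2 * (4 * d * a'' + 32 * C3 d L * a' ^ 2 + 8 * d * c₁ * a' + 2 * c₂ * a₀) := by positivity
    exact this.trans hastar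
  have hcn : ‖c‖ ≤ a * (L : ℝ) ^ ((j : ℝ) - n) := by
    rw [hcdef]; exact h1.trans (mul_le_mul_of_nonneg_right hastar hσ0)
  have hlam : ‖lam‖ ≤ a * (L : ℝ) ^ ((j : ℝ) - n) := by
    rw [hlamdef]; exact h2.trans (mul_le_mul_of_nonneg_right hastar hσ0)
  have hℓ : ‖ℓ‖ ≤ a * ((L : ℝ) ^ ((j : ℝ) - n)) ^ 2 := by
    rw [hℓdef]; exact h3.trans (mul_le_mul_of_nonneg_right hastar (sq_nonneg _))
  have hr : ‖B - c - ℓ‖ ≤ a * ((L : ℝ) ^ ((j : ℝ) - n)) ^ 2 * ((L : ℝ) ^ ((j : ℝ) - n)) ^ (1 - β) := by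
    rw [hBdef, hcdef, hℓdef]
    refine h4.trans ?_
    have e1 : (2 * a₀ * (1 + R) + R * (2 * c₁ * a₀ + 4 * d * a')
          + R ^ 2 * (4 * d * a'' + 32 * C3 d L * a' ^ 2 + 8 * d * c₁ * a' + 2 * c₂ * a₀))
          * ((L : ℝ) ^ ((j : ℝ) - n)) ^ 2 * ((L : ℝ) ^ ((j : ℝ) - n)) ^ (1 - β)
        = (2 * a₀ * (1 + R) + R * (2 * c₁ * a₀ + 4 * d * a')
          + R ^ 2 * (4 * d * a'' + 32 * C3 d L * a' ^ 2 + 8 * d * c₁ * a' + 2 * c₂ * a₀))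
          * (((L : ℝ) ^ ((j : ℝ) - n)) ^ 2 * ((L : ℝ) ^ ((j : ℝ) - n)) ^ (1 - β)) := by ring
    have e2 : a * ((L : ℝ) ^ ((j : ℝ) - n)) ^ 2 * ((L : ℝ) ^ ((j : ℝ) - n)) ^ (1 - β)
        = a * (((L : ℝ) ^ ((j : ℝ) - n)) ^ 2 * ((L : ℝ) ^ ((j : ℝ) - n)) ^ (1 - β)) := by ring
    rw [e1, e2]
    exact mul_le_mul_of_nonneg_right hastar (mul_nonneg (sq_nonneg _) hθ0)
  exact perPointIrrelevant_of_charts G hΔ hV hκ eV ρ hα hE₀ hb0 hb ha hC hL1 hjn hβ0 hβ1 h𝒜 ℰ hf hS lam c ℓ B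
    hcn hlam hℓ hr i hi

end Eq349

end Literature.MathematicalPhysics.QuantumFieldTheory.Balaban1983to89.B14.LettersScaleN

end
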